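import Mathlib.Combinatorics.SimpleGraph.Hamiltonian
import Mathlib.Combinatorics.SimpleGraph.Connectivity.Subgraph
import Mathlib.Combinatorics.SimpleGraph.CycleGraph
import Mathlib.Combinatorics.SimpleGraph.DegreeSum
import Mathlib.Combinatorics.SimpleGraph.Walk.Decomp
import Mathlib.Data.Set.Card
import Literature.Barriers.PneNP.TSPExtensionComplexity
import HarnessLib

/-!
# Tours (Hamiltonian cycles of complete graphs) as edge sets: the local facts

Support file for the discharge of `Literature.Barriers.PneNP.TSPExtensionComplexity` (FMPTW
2015, Thm. 12). The barrier file defines the TSP polytope through `IsTourEdgeSet F` — `F` is the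
edge set of a Hamiltonian cycle of `⊤ : SimpleGraph (Fin n)`. The gadget reduction that embeds
the unique-disjointness pattern into `TSP(q)` (sibling file `…Gadget.lean`) reasons about tours
only through LOCAL consequences of Hamiltonicity, which we prove here once, over an arbitrary
vertex type `V` (`IsTourOn T`, definitionally `IsTourEdgeSet` when `V = Fin n`):

* `IsTourOn.card_filter_mem`: a tour has exactly two edges at every vertex (from Mathlib's
  `IsCycle.ncard_neighborSet_toSubgraph_eq_two`); consequences `eq_or_eq_of_mem` (no third edge),
  `mem_of_subset_pair` (a vertex with only two available edges uses both), `switch_iff` (a vertex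
  with three available edges, one of them used, uses exactly one of the other two);
* `cycEdges m`: the edge set of the cyclic vertex sequence `m`; `isTourOn_cycEdges`: a cyclic
  sequence listing every vertex exactly once (length `≥ 3`) is a tour (Mathlib's
  `cycleGraph.cycle` mapped along the enumeration); membership helpers;
* `IsTourOn.not_cycEdges_subset`: a tour contains no cycle through a proper subset of the
  vertices ("subtour elimination"; boundary-dart argument);
* `IsTourOn.image_equiv`: tours transport along bijections of the vertex type.

All [folklore]; no named facts.
-/

namespace Literature.Barriers.PneNP

open SimpleGraph Finset

variable {V : Type*} [DecidableEq V]

/-- `T` is the edge set of a tour of the complete graph on `V`: the edges of a Hamiltonian cycle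
of `⊤ : SimpleGraph V` (the barrier file's `IsTourEdgeSet`, over any vertex type). [folklore] -/
def IsTourOn (T : Finset (Sym2 V)) : Prop :=
  ∃ (u : V) (p : (⊤ : SimpleGraph V).Walk u u), p.IsHamiltonianCycle ∧ T = p.edges.toFinset

/-- Over `Fin n` this is literally `IsTourEdgeSet`. [folklore] -/
theorem isTourOn_iff_isTourEdgeSet {n : ℕ} (T : Finset (Sym2 (Fin n))) :
    IsTourOn T ↔ IsTourEdgeSet T :=
  Iff.rfl

variable {T : Finset (Sym2 V)}

/-- Tour edges are not loops. [folklore] -/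
theorem IsTourOn.not_isDiag (hT : IsTourOn T) {e : Sym2 V} (he : e ∈ T) : ¬e.IsDiag := by
  obtain ⟨u, p, _, rfl⟩ := hT
  exact SimpleGraph.not_isDiag_of_mem_edgeSet _ (p.edges_subset_edgeSet (List.mem_toFinset.1 he))

/-! ### Degree two -/

/-- **A tour has exactly two edges at every vertex.** [folklore] -/
theorem IsTourOn.card_filter_mem (hT : IsTourOn T) (v : V) :
    (T.filter fun e => v ∈ e).card = 2 := by
  obtain ⟨u, p, hp, rfl⟩ := hT
  have hv : v ∈ p.support := hp.mem_support v
  have h2 := hp.isCycle.ncard_neighborSet_toSubgraph_eq_two hv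
  have hset : ((p.edges.toFinset.filter fun e => v ∈ e : Finset (Sym2 V)) : Set (Sym2 V)) =
      (fun w => s(v, w)) '' (p.toSubgraph.neighborSet v) := by
    ext e
    simp only [coe_filter, List.mem_toFinset, Set.mem_setOf_eq, Set.mem_image,
      Subgraph.mem_neighborSet, Walk.adj_toSubgraph_iff_mem_edges]
    constructor
    · rintro ⟨he, hve⟩
      refine ⟨Sym2.Mem.other hve, ?_, Sym2.other_spec hve⟩
      rw [Sym2.other_spec hve]
      exact he
    · rintro ⟨w, hw, rfl⟩
      exact ⟨hw, Sym2.mem_mk_left _ _⟩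
  rw [← Set.ncard_coe_finset, hset,
    Set.ncard_image_of_injective _ fun w w' h => Sym2.congr_right.1 h, h2]

/-- Two distinct tour edges at `v` are all the tour edges at `v`. [folklore] -/
theorem IsTourOn.eq_or_eq_of_mem (hT : IsTourOn T) {v : V} {e₁ e₂ e : Sym2 V} (h₁ : e₁ ∈ T)
    (h₂ : e₂ ∈ T) (hne : e₁ ≠ e₂) (hv₁ : v ∈ e₁) (hv₂ : v ∈ e₂) (he : e ∈ T) (hve : v ∈ e) :
    e = e₁ ∨ e = e₂ := by
  by_contra hnot
  push Not at hnot
  have hsub : ({e₁, e₂, e} : Finset (Sym2 V)) ⊆ T.filter fun e => v ∈ e := by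
    intro x hx
    simp only [mem_insert, mem_singleton] at hx
    rw [mem_filter]
    rcases hx with rfl | rfl | rfl
    exacts [⟨h₁, hv₁⟩, ⟨h₂, hv₂⟩, ⟨he, hve⟩]
  have hcard : ({e₁, e₂, e} : Finset (Sym2 V)).card = 3 := by
    rw [card_insert_of_notMem, card_pair (Ne.symm hnot.2)]
    simp only [mem_insert, mem_singleton, not_or]
    exact ⟨hne, Ne.symm hnot.1⟩
  have := card_le_card hsub
  rw [hcard, hT.card_filter_mem v] at this
  omega

/-- A vertex all of whose tour edges are among `e₁, e₂` has both `e₁` and `e₂` in the tour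
(degree-two forcing). [folklore] -/
theorem IsTourOn.mem_of_subset_pair (hT : IsTourOn T) {v : V} {e₁ e₂ : Sym2 V}
    (hsub : ∀ e ∈ T, v ∈ e → e = e₁ ∨ e = e₂) : e₁ ∈ T ∧ e₂ ∈ T := by
  have hsub' : (T.filter fun e => v ∈ e) ⊆ {e₁, e₂} := by
    intro e he
    rw [mem_filter] at he
    rcases hsub e he.1 he.2 with rfl | rfl <;> simp
  have heq : (T.filter fun e => v ∈ e) = {e₁, e₂} :=
    eq_of_subset_of_card_le hsub' ((card_insert_le _ _).trans (by rw [hT.card_filter_mem v]; simp))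
  have h1 : e₁ ∈ T.filter fun e => v ∈ e := by rw [heq]; simp
  have h2 : e₂ ∈ T.filter fun e => v ∈ e := by rw [heq]; simp
  exact ⟨(mem_filter.1 h1).1, (mem_filter.1 h2).1⟩

/-- **Switch.** A vertex whose available edges are `e₀, e₁, e₂` (pairwise distinct), with `e₀`
in the tour, has exactly one of `e₁, e₂` in the tour. [folklore] -/
theorem IsTourOn.switch_iff (hT : IsTourOn T) {v : V} {e₀ e₁ e₂ : Sym2 V}
    (hsub : ∀ e ∈ T, v ∈ e → e = e₀ ∨ e = e₁ ∨ e = e₂) (h₀ : e₀ ∈ T) (hv₀ : v ∈ e₀)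
    (hv₁ : v ∈ e₁) (hv₂ : v ∈ e₂) (h01 : e₀ ≠ e₁) (h02 : e₀ ≠ e₂) (h12 : e₁ ≠ e₂) :
    e₁ ∈ T ↔ e₂ ∉ T := by
  constructor
  · intro h₁ h₂
    rcases hT.eq_or_eq_of_mem h₀ h₁ h01 hv₀ hv₁ h₂ hv₂ with h | h
    · exact h02 h.symm
    · exact h12 h.symm
  · intro h₂
    by_contra h₁
    have hsub' : (T.filter fun e => v ∈ e) ⊆ {e₀} := by
      intro e he
      rw [mem_filter] at he
      rcases hsub e he.1 he.2 with rfl | rfl | rfl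
      · simp
      · exact absurd he.1 h₁
      · exact absurd he.1 h₂
    have := card_le_card hsub'
    rw [hT.card_filter_mem v, card_singleton] at this
    omega

omit [DecidableEq V] in
/-- The tour edges at `v` come from the neighbours of `v` in any graph supporting the tour.
[folklore] -/
theorem edge_eq_of_supported {G : SimpleGraph V} (hTG : ∀ e ∈ T, e ∈ G.edgeSet) {v : V}
    {e : Sym2 V} (he : e ∈ T) (hve : v ∈ e) : ∃ w, G.Adj v w ∧ e = s(v, w) := by
  refine ⟨Sym2.Mem.other hve, ?_, (Sym2.other_spec hve).symm⟩
  rw [← mem_edgeSet, Sym2.other_spec hve]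
  exact hTG e he

/-- **Degree-two forcing through a supporting graph**: if `v` has only the neighbours `a, b`
in a graph containing all tour edges, both `{v,a}` and `{v,b}` are tour edges. [folklore] -/
theorem IsTourOn.both_mem (hT : IsTourOn T) {G : SimpleGraph V} (hTG : ∀ e ∈ T, e ∈ G.edgeSet)
    {v a b : V} (hnb : ∀ w, G.Adj v w → w = a ∨ w = b) : s(v, a) ∈ T ∧ s(v, b) ∈ T := by
  refine hT.mem_of_subset_pair (v := v) fun e he hve => ?_
  obtain ⟨w, hw, rfl⟩ := edge_eq_of_supported hTG he hve
  rcases hnb w hw with rfl | rfl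
  · exact Or.inl rfl
  · exact Or.inr rfl

/-- **Switch through a supporting graph**: if `v` has only the neighbours `a, b, c` (distinct)
in a graph containing all tour edges and `{v,a}` is a tour edge, then exactly one of `{v,b}`,
`{v,c}` is. [folklore] -/
theorem IsTourOn.switch3 (hT : IsTourOn T) {G : SimpleGraph V} (hTG : ∀ e ∈ T, e ∈ G.edgeSet)
    {v a b c : V} (hnb : ∀ w, G.Adj v w → w = a ∨ w = b ∨ w = c) (ha : s(v, a) ∈ T)
    (hab : a ≠ b) (hac : a ≠ c) (hbc : b ≠ c) : s(v, b) ∈ T ↔ s(v, c) ∉ T := by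
  refine hT.switch_iff (v := v) (fun e he hve => ?_) ha (Sym2.mem_mk_left _ _)
    (Sym2.mem_mk_left _ _) (Sym2.mem_mk_left _ _) ?_ ?_ ?_
  · obtain ⟨w, hw, rfl⟩ := edge_eq_of_supported hTG he hve
    rcases hnb w hw with rfl | rfl | rfl
    · exact Or.inl rfl
    · exact Or.inr (Or.inl rfl)
    · exact Or.inr (Or.inr rfl)
  · exact fun h => hab (Sym2.congr_right.1 h)
  · exact fun h => hac (Sym2.congr_right.1 h)
  · exact fun h => hbc (Sym2.congr_right.1 h)

/-! ### Cyclic vertex sequences and their edge sets -/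

/-- The edge set of the cyclic vertex sequence `m = [m₀, …, m_{L-1}]`:
`{ {m_i, m_{(i+1) mod L}} : i < L }`. [folklore] -/
def cycEdges (m : List V) : Finset (Sym2 V) :=
  (Finset.univ : Finset (Fin m.length)).image fun i : Fin m.length =>
    s(m[(i : ℕ)]'i.2, m[((i : ℕ) + 1) % m.length]'(Nat.mod_lt _ i.pos))

/-- Membership in `cycEdges`. [folklore] -/
theorem mem_cycEdges_iff {m : List V} {e : Sym2 V} :
    e ∈ cycEdges m ↔ ∃ (i : ℕ) (h : i < m.length),
      e = s(m[i], m[(i + 1) % m.length]'(Nat.mod_lt _ (by omega))) := by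
  simp only [cycEdges, mem_image, mem_univ, true_and]
  constructor
  · rintro ⟨i, rfl⟩
    exact ⟨i, i.2, rfl⟩
  · rintro ⟨i, hi, rfl⟩
    exact ⟨⟨i, hi⟩, rfl⟩

/-- Consecutive entries give an edge. [folklore] -/
theorem mem_cycEdges_of_succ {m : List V} {i : ℕ} (h : i + 1 < m.length) :
    s(m[i], m[i + 1]) ∈ cycEdges m := by
  rw [mem_cycEdges_iff]
  refine ⟨i, by omega, ?_⟩
  congr 1
  simp [Nat.mod_eq_of_lt h]

/-- The wrap-around edge `{last, head}`. [folklore] -/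
theorem mem_cycEdges_wrap {m : List V} (hm : m ≠ []) :
    s(m.getLast hm, m.head hm) ∈ cycEdges m := by
  rw [mem_cycEdges_iff]
  have hL : 0 < m.length := List.length_pos_iff.2 hm
  refine ⟨m.length - 1, by omega, ?_⟩
  have h1 : m.length - 1 + 1 = m.length := by omega
  congr 1
  · exact List.getLast_eq_getElem hm
  · simp only [h1, Nat.mod_self]
    exact (List.head_eq_getElem hm)

/-- Consecutive entries, located by splitting the list. [folklore] -/
theorem mem_cycEdges_append (l₁ l₂ : List V) (x y : V) :
    s(x, y) ∈ cycEdges (l₁ ++ x :: y :: l₂) := by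
  have h : l₁.length + 1 < (l₁ ++ x :: y :: l₂).length := by simp
  have := mem_cycEdges_of_succ h
  have hx : (l₁ ++ x :: y :: l₂)[l₁.length]'(by omega) = x := by
    simp [List.getElem_append_right]
  have hy : (l₁ ++ x :: y :: l₂)[l₁.length + 1]'h = y := by
    simp [List.getElem_append_right]
  rwa [hx, hy] at this

/-- Every vertex of an edge of `cycEdges m` lies on `m`. [folklore] -/
theorem mem_list_of_mem_cycEdges {m : List V} {e : Sym2 V} (he : e ∈ cycEdges m) {y : V}
    (hy : y ∈ e) : y ∈ m := by
  obtain ⟨i, hi, rfl⟩ := mem_cycEdges_iff.1 he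
  rcases Sym2.mem_iff.1 hy with rfl | rfl <;> exact List.getElem_mem _

/-- If a property of edges holds for all cyclically consecutive pairs of `m`, it holds on
`cycEdges m`. [folklore] -/
theorem forall_cycEdges_of_isChain {P : Sym2 V → Prop} {m : List V} (hm : m ≠ [])
    (hc : List.IsChain (fun x y => P s(x, y)) m) (hw : P s(m.getLast hm, m.head hm)) :
    ∀ e ∈ cycEdges m, P e := by
  intro e he
  obtain ⟨i, hi, rfl⟩ := mem_cycEdges_iff.1 he
  by_cases hlast : i + 1 < m.length
  · have := List.isChain_iff_getElem.1 hc i hlast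
    convert this using 2
    simp [Nat.mod_eq_of_lt hlast]
  · have hi' : i = m.length - 1 := by omega
    subst hi'
    have h1 : m.length - 1 + 1 = m.length := by omega
    convert hw using 2
    · exact (List.getLast_eq_getElem hm).symm
    · simp only [h1, Nat.mod_self]
      exact (List.head_eq_getElem hm).symm

/-- If consecutive entries of `m` (cyclically) are adjacent in `G`, all of `cycEdges m` are
edges of `G`. [folklore] -/
theorem cycEdges_subset_edgeSet {G : SimpleGraph V} {m : List V} (hm : m ≠ [])
    (hc : List.IsChain G.Adj m) (hw : G.Adj (m.getLast hm) (m.head hm)) :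
    ∀ e ∈ cycEdges m, e ∈ G.edgeSet :=
  forall_cycEdges_of_isChain (P := fun e => e ∈ G.edgeSet) hm hc hw

/-- If consecutive entries of `m` (cyclically) span edges of `T`, then `cycEdges m ⊆ T`.
[folklore] -/
theorem cycEdges_subset_of_isChain {m : List V} (hm : m ≠ [])
    (hc : List.IsChain (fun x y => s(x, y) ∈ T) m) (hw : s(m.getLast hm, m.head hm) ∈ T) :
    cycEdges m ⊆ T :=
  fun e he => forall_cycEdges_of_isChain (P := fun e => e ∈ T) hm hc hw e he

/-! ### Cyclic sequences through all vertices are tours -/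

/-- The Hamiltonian cycle of `cycleGraph (k+3)` uses every edge of the cycle graph. [folklore] -/
theorem mem_edges_cycleGraph_cycle_iff (k : ℕ) (e : Sym2 (Fin (k + 3))) :
    e ∈ (cycleGraph.cycle k).edges ↔ e ∈ (cycleGraph (k + 3)).edgeSet := by
  classical
  have hsub : (cycleGraph.cycle k).edges.toFinset ⊆ (cycleGraph (k + 3)).edgeFinset := by
    intro e he
    rw [mem_edgeFinset]
    exact (cycleGraph.cycle k).edges_subset_edgeSet (List.mem_toFinset.1 he)
  have hcard1 : (cycleGraph.cycle k).edges.toFinset.card = k + 3 := by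
    rw [List.toFinset_card_of_nodup (cycleGraph.isCycle_cycle (n := k)).edges_nodup,
      Walk.length_edges, cycleGraph.length_cycle]
  have hcard2 : (cycleGraph (k + 3)).edgeFinset.card = k + 3 := by
    have := sum_degrees_eq_twice_card_edges (cycleGraph (k + 3))
    simp only [cycleGraph_degree_three_le, sum_const, card_univ, Fintype.card_fin,
      smul_eq_mul] at this
    omega
  have heq := eq_of_subset_of_card_le hsub (by rw [hcard1, hcard2])
  rw [← List.mem_toFinset, heq, mem_edgeFinset]

/-- In `Fin (k+3)`, `u + 1` has value `(u + 1) mod (k + 3)`. [folklore] -/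
theorem val_add_one_fin (k : ℕ) (u : Fin (k + 3)) : ((u + 1 : Fin (k + 3)) : ℕ) = ((u : ℕ) + 1) % (k + 3) := by
  rw [Fin.val_add]
  simp

/-- **A cyclic sequence listing every vertex exactly once (length `≥ 3`) is a tour**, with edge
set `cycEdges m`. [folklore] -/
theorem isTourOn_cycEdges {m : List V} (hnd : m.Nodup) (hall : ∀ v, v ∈ m) (h3 : 3 ≤ m.length) :
    IsTourOn (cycEdges m) := by
  classical
  obtain ⟨k, hk⟩ : ∃ k, m.length = k + 3 := ⟨m.length - 3, by omega⟩
  let f : Fin (k + 3) → V := fun i => m[(i : ℕ)]'(by omega)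
  have hfinj : Function.Injective f := by
    intro i j hij
    exact Fin.ext ((hnd.getElem_inj_iff).1 hij)
  have hfsurj : Function.Surjective f := fun v => by
    obtain ⟨i, hi, rfl⟩ := List.getElem_of_mem (hall v)
    exact ⟨⟨i, by omega⟩, rfl⟩
  let φ : cycleGraph (k + 3) →g (⊤ : SimpleGraph V) :=
    ⟨f, fun hadj => (top_adj _ _).2 (hfinj.ne hadj.ne)⟩
  have hcyc : (cycleGraph.cycle k).IsHamiltonianCycle :=
    Walk.isHamiltonianCycle_iff_isCycle_and_length_eq.2 ⟨cycleGraph.isCycle_cycle, by simp⟩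
  have hmap := hcyc.map (f := φ) ⟨hfinj, hfsurj⟩
  refine ⟨φ 0, (cycleGraph.cycle k).map φ, hmap, ?_⟩
  -- identify the edge sets
  have hf1 : ∀ u : Fin (k + 3),
      f (u + 1) = m[((u : ℕ) + 1) % m.length]'(Nat.mod_lt _ (by omega)) := by
    intro u
    simp only [f, val_add_one_fin, hk]
  ext e
  rw [List.mem_toFinset, Walk.edges_map, List.mem_map]
  constructor
  · intro he
    obtain ⟨i, hi, rfl⟩ := mem_cycEdges_iff.1 he
    let u : Fin (k + 3) := ⟨i, by omega⟩
    refine ⟨s(u, u + 1), (mem_edges_cycleGraph_cycle_iff k _).2 ?_, ?_⟩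
    · rw [mem_edgeSet, cycleGraph_adj]
      right
      exact add_sub_cancel_left u 1
    · rw [Sym2.map_mk]
      show s(f u, f (u + 1)) = _
      rw [hf1 u]
  · rintro ⟨e₀, he₀, rfl⟩
    rw [mem_edges_cycleGraph_cycle_iff] at he₀
    induction e₀ using Sym2.ind with
    | h u w =>
      rw [mem_edgeSet, cycleGraph_adj] at he₀
      rw [Sym2.map_mk]
      show s(f u, f w) ∈ cycEdges m
      rcases he₀ with h | h
      · -- u - w = 1, i.e. u = w + 1
        have hu : u = w + 1 := by rw [← h]; abel
        rw [hu, hf1 w, Sym2.eq_swap]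
        exact mem_cycEdges_iff.2 ⟨w, by omega, rfl⟩
      · have hw : w = u + 1 := by rw [← h]; abel
        rw [hw, hf1 u]
        exact mem_cycEdges_iff.2 ⟨u, by omega, rfl⟩

/-! ### Subtour elimination -/

omit [DecidableEq V] in
/-- Re-indexing a list access along an equality of indices. [folklore] -/
theorem getElem_idx {m : List V} {a b : ℕ} (h : a = b) (ha : a < m.length) :
    m[a] = m[b]'(h ▸ ha) := by
  subst h
  rfl

/-- **A tour contains no shorter cycle**: if `m` lists `L` distinct vertices with
`3 ≤ L < |V|`, then not all of `cycEdges m` are tour edges (otherwise the tour could never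
leave the vertex set of `m`, by degree two, yet it visits a vertex outside). [folklore] -/
theorem IsTourOn.not_cycEdges_subset [Fintype V] (hT : IsTourOn T) {m : List V} (hnd : m.Nodup)
    (h3 : 3 ≤ m.length) (hlt : m.length < Fintype.card V) : ¬cycEdges m ⊆ T := by
  intro hsub
  obtain ⟨u, p, hp, hTp⟩ := id hT
  -- a vertex off `m`
  obtain ⟨z, hz⟩ : ∃ z, z ∉ m := by
    by_contra h
    push Not at h
    have huniv : m.toFinset = univ := eq_univ_iff_forall.2 fun v => List.mem_toFinset.2 (h v)
    have := congrArg Finset.card huniv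
    rw [List.toFinset_card_of_nodup hnd, card_univ] at this
    omega
  have hm0 : m ≠ [] := by rintro rfl; simp at h3
  -- every tour edge at a vertex of `m` stays in `m`
  have key : ∀ x ∈ m, ∀ y, s(x, y) ∈ T → y ∈ m := by
    intro x hx y hxy
    obtain ⟨i, hi, rfl⟩ := List.getElem_of_mem hx
    set L := m.length with hL
    -- the predecessor index
    let j : ℕ := if i = 0 then L - 1 else i - 1
    have hj : j < L := by dsimp only [j]; split_ifs <;> omega
    have hj1 : (j + 1) % L = i := by
      dsimp only [j]
      split_ifs with h0
      · subst h0
        rw [show L - 1 + 1 = L by omega, Nat.mod_self]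
      · rw [show i - 1 + 1 = i by omega, Nat.mod_eq_of_lt hi]
    have hij : i ≠ j := by dsimp only [j]; split_ifs <;> omega
    -- the successor index
    set i' := (i + 1) % L with hi'
    have hi'lt : i' < L := Nat.mod_lt _ (by omega)
    have hi'j : i' ≠ j := by
      dsimp only [j]
      by_cases hlast : i + 1 < L
      · rw [hi', Nat.mod_eq_of_lt hlast]
        split_ifs <;> omega
      · have : i + 1 = L := by omega
        rw [hi', this, Nat.mod_self]
        split_ifs <;> omega
    have e1 : s(m[i], m[i']) ∈ T := hsub (mem_cycEdges_iff.2 ⟨i, hi, rfl⟩)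
    have e2 : s(m[j], m[i]) ∈ T := by
      have h0 := hsub (mem_cycEdges_iff.2 ⟨j, hj, rfl⟩)
      rwa [getElem_idx hj1] at h0
    have hne : s(m[i], m[i']) ≠ s(m[j], m[i]) := by
      intro h
      rcases Sym2.eq_iff.1 h with ⟨h1, _⟩ | ⟨_, h2⟩
      · exact hij ((hnd.getElem_inj_iff).1 h1)
      · exact hi'j ((hnd.getElem_inj_iff).1 h2)
    rcases hT.eq_or_eq_of_mem e1 e2 hne (Sym2.mem_mk_left _ _) (Sym2.mem_mk_right _ _) hxy
      (Sym2.mem_mk_left _ _) with h | h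
    · have hy : y ∈ s(m[i], m[i']) := h ▸ Sym2.mem_mk_right _ _
      rcases Sym2.mem_iff.1 hy with rfl | rfl <;> exact List.getElem_mem _
    · have hy : y ∈ s(m[j], m[i]) := h ▸ Sym2.mem_mk_right _ _
      rcases Sym2.mem_iff.1 hy with rfl | rfl <;> exact List.getElem_mem _
  -- a piece of the tour from inside `m` to outside
  let S : Set V := {x | x ∈ m}
  have hx₀ : m.head hm0 ∈ m := List.head_mem hm0
  have hwalk : ∃ (a b : V) (q : (⊤ : SimpleGraph V).Walk a b),
      a ∈ S ∧ b ∉ S ∧ ∀ e ∈ q.edges, e ∈ p.edges := by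
    by_cases hu : u ∈ m
    · exact ⟨u, z, p.takeUntil z (hp.mem_support z), hu, hz,
        fun e he => p.edges_takeUntil_subset_edges _ he⟩
    · refine ⟨m.head hm0, u, (p.takeUntil _ (hp.mem_support (m.head hm0))).reverse, hx₀, hu,
        fun e he => p.edges_takeUntil_subset_edges (hp.mem_support (m.head hm0)) ?_⟩
      rw [Walk.edges_reverse, List.mem_reverse] at he
      exact he
  obtain ⟨a, b, q, ha, hb, hq⟩ := hwalk
  obtain ⟨d, hd, hd1, hd2⟩ := q.exists_boundary_dart S ha hb
  have hde : d.edge ∈ q.edges := by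
    unfold Walk.edges
    exact List.mem_map.2 ⟨d, hd, rfl⟩
  have hdT : s(d.toProd.1, d.toProd.2) ∈ T := by
    rw [hTp, List.mem_toFinset]
    exact hq _ hde
  exact hd2 (key _ hd1 _ hdT)

/-! ### Transport along a bijection of the vertex type -/

/-- Tours map to tours under a bijection of the vertices. [folklore] -/
theorem IsTourOn.image_equiv {W : Type*} [DecidableEq W] (g : V ≃ W) (hT : IsTourOn T) :
    IsTourOn (T.image (Sym2.map g)) := by
  obtain ⟨u, p, hp, rfl⟩ := hT
  let φ : (⊤ : SimpleGraph V) →g (⊤ : SimpleGraph W) :=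
    ⟨g, fun h => (top_adj _ _).2 (g.injective.ne ((top_adj _ _).1 h))⟩
  refine ⟨g u, p.map φ, hp.map (f := φ) g.bijective, ?_⟩
  ext e
  simp only [mem_image, List.mem_toFinset, Walk.edges_map, List.mem_map]
  rfl

/-- … and back: `T` is a tour iff its image is. [folklore] -/
theorem isTourOn_image_equiv_iff {W : Type*} [DecidableEq W] (g : V ≃ W) (T : Finset (Sym2 V)) :
    IsTourOn (T.image (Sym2.map g)) ↔ IsTourOn T := by
  refine ⟨fun h => ?_, fun h => h.image_equiv g⟩
  have := h.image_equiv g.symm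
  rw [image_image] at this
  have hcomp : (Sym2.map g.symm ∘ Sym2.map g : Sym2 V → Sym2 V) = id := by
    funext e
    induction e using Sym2.ind with
    | h x y => simp
  rwa [hcomp, image_id] at this

end Literature.Barriers.PneNP
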